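import Mathlib.Analysis.Complex.AbsMax
import Mathlib.Analysis.Analytic.Order
import Mathlib.Analysis.SpecialFunctions.Complex.LogDeriv
import Mathlib.Analysis.SpecialFunctions.Pow.Complex
import Mathlib.Analysis.Calculus.MeanValue
import Mathlib.Topology.DiscreteSubset
import Mathlib.Order.Interval.Set.Infinite
import Literature.NumberTheory.DiophantineApproximation.KroneckerPrimes
import HarnessLib

/-!
# Tools for Saias–Weingartner's Theorem 2: a Rouché substitute, relatively dense Kronecker
# times, zero-free horizontal segments, and two Lipschitz estimates

Topic `Literature/NumberTheory/LFunctions` (namespace `Literature.NumberTheory.LFunctions`).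
Everything in this file is PROVED; there are no definitions and no named facts. These are the
analytic tools of §4 of Saias–Weingartner, *Zeros of Dirichlet series with periodic
coefficients*, Acta Arith. 140 (2009), in the form used by `SaiasWeingartnerProofs.lean`:

* `SWTools.exists_zero_of_norm_lt` — **a substitute for Rouché's theorem** ("it follows by
  Rouché's theorem that `F(s+it)` has at least one zero in `|s-σ| < r`"): if `Ψ` is holomorphic
  on a closed disc, `‖Ψ(c)‖ < m` at the centre and `‖Ψ‖ ≥ m` on the boundary circle, then `Ψ`
  has a zero in the open disc (maximum modulus principle applied to `1/Ψ`).
* `SWTools.exists_relDense_prime_phases` — **Kronecker's theorem with relatively dense times**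
  (the paper's "by Weyl's criterion … the set of `t` … has positive lower density", in the
  weaker form that suffices for `N'_F(σ₁, σ₂, T) ≫ T`): for unimodular targets `ω_p` (`p ≤ M`)
  and `ε > 0` there is `L` such that every real interval `[s₀ - L, s₀ + L]` contains a `t` with
  `|p^{-it} - ω_p| < ε` for all primes `p ≤ M` (Kronecker's theorem of the tree,
  `Kronecker.exists_abs_ge_forall_prime_norm_cpow_sub_lt`, and compactness of the torus).
* `SWTools.exists_forall_ne_zero_horizontal` — finitely many entire functions, none identically
  zero, have a common zero-free horizontal segment `{σ + iτ : a ≤ σ ≤ b}` (isolated zeros are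
  finite in number on a compact rectangle).
* `SWTools.norm_log_one_sub_sub_le`, `SWTools.norm_exp_sub_exp_le` — Lipschitz bounds for
  `log (1 - z)` on `|z| ≤ 1/2` and for `exp`.

## References

* [SaiasWeingartner2009] E. Saias, A. Weingartner, Acta Arith. 140 (2009), 335–344, §4.
* [Titchmarsh1986] E. C. Titchmarsh, *The Theory of the Riemann Zeta-Function*, 2nd ed.,
  §8.8, §10.25 (Kronecker's theorem for the prime phases).
-/

noncomputable section

open Complex Filter Metric Set
open scoped Topology

namespace Literature.NumberTheory.LFunctions

namespace SWTools

/-! ### A substitute for Rouché's theorem -/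

/-- **Zeros from the maximum modulus principle** (used in place of Rouché's theorem in
[SaiasWeingartner2009], §4): if `Ψ` is complex differentiable on the closed disc
`closedBall c r`, `‖Ψ c‖ < m`, and `m ≤ ‖Ψ z‖` on the circle `sphere c r`, then `Ψ` vanishes
somewhere in the open disc. (Otherwise `1/Ψ` would violate the maximum modulus principle.)
[folklore] -/
theorem exists_zero_of_norm_lt {Ψ : ℂ → ℂ} {c : ℂ} {r m : ℝ} (hr : 0 < r)
    (hΨ : ∀ z ∈ closedBall c r, DifferentiableAt ℂ Ψ z) (hc : ‖Ψ c‖ < m)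
    (hsphere : ∀ z ∈ sphere c r, m ≤ ‖Ψ z‖) : ∃ z ∈ ball c r, Ψ z = 0 := by
  by_contra h
  push Not at h
  have hm : 0 < m := lt_of_le_of_lt (norm_nonneg _) hc
  have hne : ∀ z ∈ closedBall c r, Ψ z ≠ 0 := by
    intro z hz
    rcases eq_or_lt_of_le (mem_closedBall.1 hz) with h' | h'
    · intro h0
      have := hsphere z (mem_sphere.2 h')
      rw [h0, norm_zero] at this
      linarith
    · exact h z (mem_ball.2 h')
  have hd : DiffContOnCl ℂ (fun z ↦ (Ψ z)⁻¹) (ball c r) := by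
    refine ⟨fun z hz ↦ ?_, fun z hz ↦ ?_⟩
    · exact ((hΨ z (ball_subset_closedBall hz)).inv (hne z (ball_subset_closedBall hz)))
        |>.differentiableWithinAt
    · rw [closure_ball c hr.ne'] at hz
      exact ((hΨ z hz).continuousAt.inv₀ (hne z hz)).continuousWithinAt
  have hbound : ∀ z ∈ frontier (ball c r), ‖(Ψ z)⁻¹‖ ≤ m⁻¹ := by
    intro z hz
    rw [frontier_ball c hr.ne'] at hz
    rw [norm_inv]
    exact inv_anti₀ hm (hsphere z hz)
  have hmax := Complex.norm_le_of_forall_mem_frontier_norm_le isBounded_ball hd hbound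
    (subset_closure (mem_ball_self hr))
  rw [norm_inv] at hmax
  have h0 : 0 < ‖Ψ c‖ := norm_pos_iff.2 (hne c (mem_closedBall_self hr.le))
  have := (inv_le_inv₀ h0 hm).1 hmax
  linarith

/-! ### Kronecker's theorem with relatively dense times -/

/-- `‖p^{it}‖ = 1` for a prime (indeed positive natural) `p` and real `t`. [folklore] -/
theorem norm_natCast_cpow_mul_I {p : ℕ} (hp : 0 < p) (t : ℝ) : ‖(p : ℂ) ^ ((t : ℂ) * I)‖ = 1 := by
  rw [norm_natCast_cpow_of_pos hp]
  simp

/-- **Kronecker's theorem for the prime phases, with relatively dense times.** For unimodular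
targets `ω_p` and `ε > 0` there is `L > 0` such that for every real `s₀` some `t` with
`|t - s₀| ≤ L` satisfies `|p^{-it} - ω_p| < ε` for all primes `p ≤ M`. (Kronecker's theorem
gives one such `t` for every point of the torus of targets; by compactness finitely many times
`t_k` serve all targets up to `ε/2`, and the target `(ω_p p^{i s₀})_p` is served by some `t_k`,
whence `t = s₀ - t_k`.) [cite: Titchmarsh1986, §10.25] -/
theorem exists_relDense_prime_phases (M : ℕ) (ω : ℕ → ℂ) (hω : ∀ p, p.Prime → ‖ω p‖ = 1)
    {ε : ℝ} (hε : 0 < ε) :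
    ∃ L : ℝ, 0 < L ∧ ∀ s₀ : ℝ, ∃ t : ℝ, |t - s₀| ≤ L ∧
      ∀ p : ℕ, p.Prime → p ≤ M → ‖(p : ℂ) ^ (-((t : ℂ) * I)) - ω p‖ < ε := by
  classical
  -- the torus of targets, inside `Fin (M+1) → ℂ`
  set T : Set (Fin (M + 1) → ℂ) := Set.pi univ fun _ ↦ sphere (0 : ℂ) 1 with hT
  have hTc : IsCompact T := isCompact_univ_pi fun _ ↦ isCompact_sphere _ _
  -- the open sets served by a time `t`
  set U : ℝ → Set (Fin (M + 1) → ℂ) := fun t ↦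
    {w | ∀ j : Fin (M + 1), (j : ℕ).Prime → ‖((j : ℕ) : ℂ) ^ ((t : ℂ) * I) - w j‖ < ε / 2} with hU
  have hUo : ∀ t, IsOpen (U t) := by
    intro t
    have : U t = ⋂ j : Fin (M + 1), {w | (j : ℕ).Prime → ‖((j : ℕ) : ℂ) ^ ((t : ℂ) * I) - w j‖
        < ε / 2} := by ext w; simp [hU]
    rw [this]
    refine isOpen_iInter_of_finite fun j ↦ ?_
    by_cases hj : (j : ℕ).Prime
    · simp only [hj, forall_true_left]
      exact isOpen_lt (continuous_norm.comp (continuous_const.sub (continuous_apply j)))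
        continuous_const
    · simp [hj]
  have hcover : T ⊆ ⋃ t, U t := by
    intro w hw
    rw [hT, Set.mem_univ_pi] at hw
    obtain ⟨t, -, ht⟩ := Literature.NumberTheory.DiophantineApproximation.Kronecker.exists_abs_ge_forall_prime_norm_cpow_sub_lt
      M (fun p ↦ if h : p < M + 1 then w ⟨p, h⟩ else 1) (fun p _ ↦ by
        split_ifs with h
        · exact mem_sphere_zero_iff_norm.1 (hw ⟨p, h⟩)
        · exact norm_one) (half_pos hε) 0
    refine Set.mem_iUnion.2 ⟨t, fun j hj ↦ ?_⟩
    have := ht j hj (Nat.lt_succ_iff.1 j.isLt)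
    simpa [j.isLt] using this
  obtain ⟨F, hF⟩ := hTc.elim_finite_subcover U hUo hcover
  refine ⟨F.sum (fun t ↦ |t|) + 1, by positivity, fun s₀ ↦ ?_⟩
  -- the rotated target
  set w : Fin (M + 1) → ℂ := fun j ↦ if (j : ℕ).Prime then
    ω j * ((j : ℕ) : ℂ) ^ ((s₀ : ℂ) * I) else 1 with hw
  have hwT : w ∈ T := by
    rw [hT, Set.mem_univ_pi]
    intro j
    rw [mem_sphere_zero_iff_norm, hw]
    simp only
    split_ifs with hj
    · rw [norm_mul, hω j hj, norm_natCast_cpow_mul_I hj.pos, one_mul]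
    · exact norm_one
  obtain ⟨tk, htkF, htk⟩ : ∃ tk ∈ F, w ∈ U tk := by
    have := hF hwT
    simpa only [Set.mem_iUnion, exists_prop] using this
  refine ⟨s₀ - tk, ?_, fun p hp hpM ↦ ?_⟩
  · rw [show s₀ - tk - s₀ = -tk by ring, abs_neg]
    have : |tk| ≤ F.sum fun t ↦ |t| := Finset.single_le_sum (fun t _ ↦ abs_nonneg t) htkF
    linarith
  · have hj := htk ⟨p, Nat.lt_succ_of_le hpM⟩ hp
    simp only [hw, hp, if_true] at hj
    have hp0 : (p : ℂ) ≠ 0 := Nat.cast_ne_zero.2 hp.ne_zero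
    have hsplit : (p : ℂ) ^ (-(((s₀ - tk : ℝ) : ℂ) * I)) =
        (p : ℂ) ^ (-((s₀ : ℂ) * I)) * (p : ℂ) ^ ((tk : ℂ) * I) := by
      rw [← cpow_add _ _ hp0]
      congr 1
      push_cast
      ring
    have hω' : ω p = (p : ℂ) ^ (-((s₀ : ℂ) * I)) * (ω p * (p : ℂ) ^ ((s₀ : ℂ) * I)) := by
      rw [mul_comm (ω p), ← mul_assoc, ← cpow_add _ _ hp0, neg_add_cancel, cpow_zero, one_mul]
    rw [hsplit, hω', ← mul_sub, norm_mul, norm_natCast_cpow_of_pos hp.pos]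
    simp only [neg_re, mul_re, ofReal_re, I_re, mul_zero, ofReal_im, I_im, mul_one, sub_self,
      neg_zero, Real.rpow_zero, one_mul]
    linarith

/-! ### Zero-free horizontal segments -/

/-- An entire function which is not identically zero has only finitely many zeros in a compact
set. [folklore] -/
theorem finite_zeros_of_isCompact {f : ℂ → ℂ} (hf : AnalyticOnNhd ℂ f univ) {z₀ : ℂ}
    (hz₀ : f z₀ ≠ 0) {K : Set ℂ} (hK : IsCompact K) : (K ∩ f ⁻¹' {0}).Finite := by
  have h1 : f ⁻¹' {0}ᶜ ∈ codiscreteWithin K :=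
    Filter.codiscreteWithin_mono (subset_univ K) (hf.preimage_zero_mem_codiscrete hz₀)
  have h2 := hK.finite_sdiff_of_mem_codiscreteWithin h1
  refine h2.subset fun z hz ↦ ?_
  exact ⟨hz.1, fun h ↦ h hz.2⟩

/-- **A common zero-free horizontal segment.** Finitely many entire functions, none identically
zero, are all zero-free on `{σ + iτ : a ≤ σ ≤ b}` for a suitable `τ ∈ [0, 1]` (the zeros in the
rectangle `[a, b] × [0, 1]` are finite in number, so only finitely many heights are excluded).
[folklore] -/
theorem exists_forall_ne_zero_horizontal {ι : Type*} [Finite ι] (f : ι → ℂ → ℂ)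
    (hf : ∀ i, AnalyticOnNhd ℂ (f i) univ) (hne : ∀ i, ∃ z, f i z ≠ 0) (a b : ℝ) :
    ∃ τ : ℝ, ∀ i, ∀ σ ∈ Icc a b, f i ((σ : ℂ) + (τ : ℂ) * I) ≠ 0 := by
  set K : Set ℂ := Icc a b ×ℂ Icc 0 1 with hK
  have hKc : IsCompact K := isCompact_Icc.reProdIm isCompact_Icc
  have hfin : ∀ i, (K ∩ f i ⁻¹' {0}).Finite := fun i ↦
    (hne i).elim fun z hz ↦ finite_zeros_of_isCompact (hf i) hz hKc
  set B : Set ℝ := ⋃ i, Complex.im '' (K ∩ f i ⁻¹' {0}) with hB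
  have hBf : B.Finite := Set.finite_iUnion fun i ↦ (hfin i).image _
  obtain ⟨τ, hτ⟩ := ((Set.Icc_infinite (zero_lt_one' ℝ)).sdiff hBf).nonempty
  refine ⟨τ, fun i σ hσ h0 ↦ hτ.2 ?_⟩
  rw [hB, Set.mem_iUnion]
  refine ⟨i, (σ : ℂ) + (τ : ℂ) * I, ⟨?_, h0⟩, by simp⟩
  rw [hK, Complex.mem_reProdIm]
  constructor <;> simpa using by first | exact hσ | exact hτ.1

/-! ### Two Lipschitz estimates -/

/-- `|log(1 - z) - log(1 - w)| ≤ 2 |z - w|` for `|z|, |w| ≤ 1/2` (mean value inequality; the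
derivative `-(1 - z)⁻¹` has modulus at most `2`). [folklore] -/
theorem norm_log_one_sub_sub_le {z w : ℂ} (hz : ‖z‖ ≤ 1 / 2) (hw : ‖w‖ ≤ 1 / 2) :
    ‖log (1 - z) - log (1 - w)‖ ≤ 2 * ‖z - w‖ := by
  have hderiv : ∀ x ∈ closedBall (0 : ℂ) (1 / 2),
      HasDerivWithinAt (fun x ↦ log (1 - x)) ((1 - x)⁻¹ * (-1)) (closedBall (0 : ℂ) (1 / 2)) x := by
    intro x hx
    rw [mem_closedBall_zero_iff] at hx
    have hslit : 1 - x ∈ slitPlane := by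
      rw [sub_eq_add_neg]
      exact mem_slitPlane_of_norm_lt_one (by rw [norm_neg]; linarith)
    have h1 : HasDerivAt (fun x : ℂ ↦ 1 - x) (-1) x := (hasDerivAt_id x).const_sub 1
    exact ((Complex.hasDerivAt_log hslit).comp x h1).hasDerivWithinAt
  have hbound : ∀ x ∈ closedBall (0 : ℂ) (1 / 2), ‖(1 - x)⁻¹ * (-1 : ℂ)‖ ≤ 2 := by
    intro x hx
    rw [mem_closedBall_zero_iff] at hx
    rw [norm_mul, norm_neg, norm_one, mul_one, norm_inv]
    have h1 : 1 / 2 ≤ ‖1 - x‖ := by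
      have := norm_sub_norm_le (1 : ℂ) x
      rw [norm_one] at this
      linarith
    calc ‖1 - x‖⁻¹ ≤ (1 / 2)⁻¹ := inv_anti₀ (by norm_num) h1
      _ = 2 := by norm_num
  have := Convex.norm_image_sub_le_of_norm_hasDerivWithin_le hderiv hbound (convex_closedBall 0 _)
    (mem_closedBall_zero_iff.2 hw) (mem_closedBall_zero_iff.2 hz)
  simpa using this

/-- `|e^a - e^b| ≤ 2 |e^b| |a - b|` when `|a - b| ≤ 1`. [folklore] -/
theorem norm_exp_sub_exp_le {a b : ℂ} (h : ‖a - b‖ ≤ 1) :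
    ‖cexp a - cexp b‖ ≤ 2 * ‖cexp b‖ * ‖a - b‖ := by
  have : cexp a - cexp b = cexp b * (cexp (a - b) - 1) := by
    rw [mul_sub, mul_one, ← Complex.exp_add, add_sub_cancel]
  rw [this, norm_mul]
  have := Complex.norm_exp_sub_one_le h
  nlinarith [norm_nonneg (cexp b), norm_nonneg (cexp (a - b) - 1)]

end SWTools

end Literature.NumberTheory.LFunctions
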